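import Summits.HodgeConjecture.HodgeConjecture.Theorems.SixfoldTableXCover
import HarnessLib

/-!
# TABLE X (dimension 6) — HC for every complex abelian sixfold OFF the residue class, from the print
# facts and the two census nodes alone (cell `pub-hodgeav-hg6`, req-37 (A) Q2b; lead g2)

HONEST FRAMING. HC, `HC_AV` (stmt-1333), `HC_CM` (`Theses.RankFourFaces.CMAbelianHodge`, stmt-3052) and the rung
H2 (`Theses.SevenfoldWeilCensus.WeilSixfolds`, stmt-2524; its open part `WeilTypeLadder.NonsplitSixfolds`) are NOT
proved; every such statement occurs below only as a HYPOTHESIS BY NAME. The two census nodes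
`TableX.SixfoldCodimTwoCensus` / `TableX.SixfoldCodimThreeCensus` (module `SixfoldTableXCover`) are OURS
(`@[conjecture]`, dossier `run/shared/lean/pub/pub-hodgeav-hg6/TABLE-X-g6-v0.md` + `-v1.md`, every load-bearing
number ×2) and are never asserted. KERNEL ONLY: theorems over existing declarations; no definition, no `sorry`,
no new named fact.

WHAT THIS MODULE ADDS. The landed cover `TableX.hcAtDim_six_of_tableX_residues` concludes `HCAtDim 6` (HC for ALL
complex abelian sixfolds) and therefore has to carry HC on the residue class `𝒞 = CM ∪ K3P` as binders (`HC_CM`,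
narrowed in v3 to the non-simple CM sixfolds plus the displayed CM-splitness `hS`; and R-K3P =
`Ring2.Atlas.HodgeQuarticTypeIVFourfoldTimesCMSurface`). The charter's literal deliverable (req-37 (A) Q2b: "the
typed theorem *HC for every 6-dimensional abelian variety whose Hodge type is not in Table X* conditional on the
named print facts") is the PER-VARIETY statement OFF the residue, and there the residue binders are not needed at
all: `hcOnClass_six_offResidue_of_tableX_residues` — GRANTED Markman's fourfold theorem (floor `dim ≤ 5`), Markman's
hyperbolic-sixfold statement (UNREFEREED preprint; Schoen `ℚ(√-3)` / Koike `ℚ(i)` refereed instances), the residue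
R-W6 = `WeilTypeLadder.NonsplitSixfolds` (OPEN, rung H2) and the two dimension-6 census nodes, the Hodge conjecture
holds for every complex abelian SIXFOLD that is neither of CM type nor in the K3-partner cell. Neither `HC_CM` (in
any form) nor R-K3P nor `hS` occurs. Reason (the proof): off `𝒞` the census nodes bound every rational `(2,2)` /
`(3,3)` class by divisor monomials, `(2,2)·(1,1)` products, pull-backs from dimension `< 6` (the FLOOR, no induction
through `𝒞` needed) and pull-backs of Weil classes of Weil sixfolds `B` — and the latter are algebraic for EVERY `B`
(inside `𝒞` or not) by `WeilSixfolds` = Markman₆ + `NonsplitSixfolds` (`WeilTypeLadder.weilSixfolds_of_nonsplitSixfolds_of_floor`);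
the other codimensions are Lefschetz `(1,1)` and hard-Lefschetz duality, as in the cover.

AUDIT (§3): the landed cover is recovered from the off-residue theorem plus HC on the residue class in dimension 6
(`hcAtDim_six_of_offResidue_of_onResidue`), so nothing is lost; and the off-residue class target is ON PATH
(`hcOnClass_six_offResidue_of_hodgeConjecture`). R-W6 cannot be dropped here: it is NECESSARY for `HCAtDim 6`
(`WeilTypeLadder.nonsplitSixfolds_of_abelianSixfolds`, ring2 `abelianSixfolds_iff_hcAtDim_six`) and it is met
non-vacuously off `𝒞` (TABLE X v1 rows 7b, 9, 13: the non-split members of the simple Weil-carrier rows).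
Nothing here is a corollary of `HC_CM`; `HC_CM` does not occur in this module.
-/

set_option linter.dupNamespace false

noncomputable section

open CategoryTheory
open Literature.AlgebraicGeometry Literature.AlgebraicGeometry.Motives
open Literature.AlgebraicGeometry.HodgeTheory
open Literature.AlgebraicGeometry.Milne1999
open Literature.AlgebraicTopology.SingularHomology
open Literature.Barriers.HodgeConjecture
open Summit.HodgeConjecture.HodgeConjecture.Ring2.ClassTargets
open Summit.HodgeConjecture.HodgeConjecture.Ring2.Motiv (ProdCMCell)
open Summit.HodgeConjecture.HodgeConjecture.Ring2.Atlas (IsQuarticFieldTypeIVFourfold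
  HodgeQuarticTypeIVFourfoldTimesCMSurface)

namespace Summit.HodgeConjecture.HodgeConjecture.TableX

/-! ## §1 Off an arbitrary class `𝒞`: census off `𝒞` + ALL Weil sixfolds + floor, no HC on `𝒞` -/

section OffClass

variable {𝒞 : AbelianVariety ℂ → Prop}
  (h₃ : ∀ A : AbelianVariety ℂ, A.dim = 6 → ¬ 𝒞 A → ∀ c : complexBetti A.X (2 * 2),
    IsRationalClass c → IsOfHodgeType A.dim A.X (2 * 2) 2 2 c →
      c ∈ divisorClassesSpan A.X A.dim 2 ⊔ Submodule.span ℂ {w' : complexBetti A.X (2 * 2) |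
        ∃ (C : AbelianVariety ℂ) (g : A.X ⟶ C.X) (w : complexBetti C.X (2 * 2)), C.dim < A.dim ∧
          IsRationalClass w ∧ IsOfHodgeType C.dim C.X (2 * 2) 2 2 w ∧ w' = complexBetti.map g (2 * 2) w})
  (h₂ : ∀ A : AbelianVariety ℂ, A.dim = 6 → ¬ 𝒞 A → ∀ c : complexBetti A.X (2 * 3),
    IsRationalClass c → IsOfHodgeType A.dim A.X (2 * 3) 3 3 c →
      c ∈ divisorClassesSpan A.X A.dim 3 ⊔ Submodule.span ℂ {w' : complexBetti A.X (2 * 3) |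
          ∃ (a : complexBetti A.X (2 * 2)) (b : complexBetti A.X (2 * 1)),
            IsRationalClass a ∧ IsOfHodgeType A.dim A.X (2 * 2) 2 2 a ∧ IsRationalClass b ∧
            IsOfHodgeType A.dim A.X (2 * 1) 1 1 b ∧ w' = cupProduct (two_mul_add_two_mul 2 1) a b} ⊔
        Submodule.span ℂ {w' : complexBetti A.X (2 * 3) |
          ∃ (C : AbelianVariety ℂ) (g : A.X ⟶ C.X) (w : complexBetti C.X (2 * 3)), C.dim < A.dim ∧
            IsRationalClass w ∧ IsOfHodgeType C.dim C.X (2 * 3) 3 3 w ∧ w' = complexBetti.map g (2 * 3) w} ⊔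
        Submodule.span ℂ {w' : complexBetti A.X (2 * 3) |
          ∃ (B : AbelianVariety ℂ) (g : A.X ⟶ B.X) (d : ℕ) (ψ : B ⟶ B) (w : complexBetti B.X (2 * 3)),
            B.dim = 6 ∧ 0 < d ∧ ψ ≫ ψ = -(d • 𝟙 B) ∧ IsRationalClass w ∧
            IsOfHodgeType B.dim B.X (2 * 3) 3 3 w ∧ w ∈ weilClassesOf B ψ 3 d ∧
            w' = complexBetti.map g (2 * 3) w})
  (h₄ : ∀ (d : ℕ), 0 < d → ∀ (B : AbelianVariety ℂ) (ψ : B ⟶ B), B.dim = 6 → ψ ≫ ψ = -(d • 𝟙 B) →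
    ∀ w : complexBetti B.X (2 * 3), IsRationalClass w → IsOfHodgeType B.dim B.X (2 * 3) 3 3 w →
      w ∈ weilClassesOf B ψ 3 d → w ∈ algebraicClasses B.X 3)
  (h₅ : HCUpToDim 5)

include h₃ h₂ h₄ h₅

/-- **The cycle part of HC for a sixfold OFF `𝒞` from: the dimension-6 census OFF `𝒞`, the Weil classes of ALL Weil
sixfolds, the floor `HCUpToDim 5`** — no hypothesis on `𝒞` itself. The proof is the dimension-6 step of
`mem_algebraicClasses_of_dim_le_six_of_censusOff` with the floor in place of the induction (every pull-back source has
dimension `≤ 5`) and `h₄` in place of HC on `𝒞` for the Weil sixfolds inside `𝒞`.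
[cite: MoonenZarhin1999LowDim, §5; arXiv:math/9901113] [cite: VoisinHodgeI2002, Thms. 6.25, 11.30] -/
theorem mem_algebraicClasses_of_dim_six_offClass (A : AbelianVariety ℂ) (h6 : A.dim = 6) (hA𝒞 : ¬ 𝒞 A) :
    ∀ (p : ℕ) (c : complexBetti A.X (2 * p)), IsRationalClass c →
      IsOfHodgeType A.dim A.X (2 * p) p p c → c ∈ algebraicClasses A.X p := by
  have hX : IsSmoothProjective A.dim A.X := AbelianVariety.isSmoothProjective_holds
  have h11 : ∀ b : complexBetti A.X (2 * 1), IsRationalClass b →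
      IsOfHodgeType A.dim A.X (2 * 1) 1 1 b → b ∈ algebraicClasses A.X 1 :=
    fun b hb hbt ↦ lefschetzOneOne_rational_holds hX b hb hbt
  have hpull : ∀ (q : ℕ) (C : AbelianVariety ℂ) (g : A.X ⟶ C.X) (w : complexBetti C.X (2 * q)),
      C.dim < A.dim → IsRationalClass w → IsOfHodgeType C.dim C.X (2 * q) q q w →
        complexBetti.map g (2 * q) w ∈ algebraicClasses A.X q := by
    intro q C g w hC hw hwt
    have hwC : w ∈ algebraicClasses C.X q := (h₅ C (by omega)).2 q w hw hwt
    exact map_mem_algebraicClasses_of_abelianVariety hX C g hwC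
  have hp2 : ∀ c : complexBetti A.X (2 * 2), IsRationalClass c →
      IsOfHodgeType A.dim A.X (2 * 2) 2 2 c → c ∈ algebraicClasses A.X 2 := by
    intro c hc hct
    have hle : divisorClassesSpan A.X A.dim 2 ⊔ Submodule.span ℂ {w' : complexBetti A.X (2 * 2) |
        ∃ (C : AbelianVariety ℂ) (g : A.X ⟶ C.X) (w : complexBetti C.X (2 * 2)), C.dim < A.dim ∧
          IsRationalClass w ∧ IsOfHodgeType C.dim C.X (2 * 2) 2 2 w ∧
          w' = complexBetti.map g (2 * 2) w} ≤ algebraicClasses A.X 2 := by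
      refine sup_le (AbelianVariety.divisorClassesSpan_le_algebraicClasses A h11 2) (Submodule.span_le.mpr ?_)
      rintro _ ⟨C, g, w, hC, hw, hwt, rfl⟩
      exact hpull 2 C g w hC hw hwt
    exact hle (h₃ A h6 hA𝒞 c hc hct)
  have hp3 : ∀ c : complexBetti A.X (2 * 3), IsRationalClass c →
      IsOfHodgeType A.dim A.X (2 * 3) 3 3 c → c ∈ algebraicClasses A.X 3 := by
    intro c hc hct
    have hcup : Submodule.span ℂ {w' : complexBetti A.X (2 * 3) |
        ∃ (a : complexBetti A.X (2 * 2)) (b : complexBetti A.X (2 * 1)),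
          IsRationalClass a ∧ IsOfHodgeType A.dim A.X (2 * 2) 2 2 a ∧ IsRationalClass b ∧
          IsOfHodgeType A.dim A.X (2 * 1) 1 1 b ∧
          w' = cupProduct (two_mul_add_two_mul 2 1) a b} ≤ algebraicClasses A.X 3 := by
      refine Submodule.span_le.mpr ?_
      rintro _ ⟨a, b, ha, hat, hb, hbt, rfl⟩
      exact AbelianVariety.cupProduct_mem_algebraicClasses_one A (hp2 a ha hat) (h11 b hb hbt)
    have hlow3 : Submodule.span ℂ {w' : complexBetti A.X (2 * 3) |
        ∃ (C : AbelianVariety ℂ) (g : A.X ⟶ C.X) (w : complexBetti C.X (2 * 3)), C.dim < A.dim ∧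
          IsRationalClass w ∧ IsOfHodgeType C.dim C.X (2 * 3) 3 3 w ∧
          w' = complexBetti.map g (2 * 3) w} ≤ algebraicClasses A.X 3 := by
      refine Submodule.span_le.mpr ?_
      rintro _ ⟨C, g, w, hC, hw, hwt, rfl⟩
      exact hpull 3 C g w hC hw hwt
    have hweil3 : Submodule.span ℂ {w' : complexBetti A.X (2 * 3) |
        ∃ (B : AbelianVariety ℂ) (g : A.X ⟶ B.X) (d : ℕ) (ψ : B ⟶ B) (w : complexBetti B.X (2 * 3)),
          B.dim = 6 ∧ 0 < d ∧ ψ ≫ ψ = -(d • 𝟙 B) ∧ IsRationalClass w ∧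
          IsOfHodgeType B.dim B.X (2 * 3) 3 3 w ∧ w ∈ weilClassesOf B ψ 3 d ∧
          w' = complexBetti.map g (2 * 3) w} ≤ algebraicClasses A.X 3 := by
      refine Submodule.span_le.mpr ?_
      rintro _ ⟨B, g, d, ψ, w, hB, hd, hψ, hw, hwt, hweil, rfl⟩
      exact map_mem_algebraicClasses_of_abelianVariety hX B g (h₄ d hd B ψ hB hψ w hw hwt hweil)
    exact (sup_le (sup_le (sup_le (AbelianVariety.divisorClassesSpan_le_algebraicClasses A h11 3)
      hcup) hlow3) hweil3) (h₂ A h6 hA𝒞 c hc hct)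
  have hlow : ∀ p : ℕ, 2 * p ≤ A.dim → ∀ c : complexBetti A.X (2 * p), IsRationalClass c →
      IsOfHodgeType A.dim A.X (2 * p) p p c → c ∈ algebraicClasses A.X p := by
    intro p hp c hc hct
    have hp3' : p ≤ 3 := by omega
    interval_cases p
    · exact hodgeConjectureFor_codim_zero c
    · exact h11 c hc hct
    · exact hp2 c hc hct
    · exact hp3 c hc hct
  intro p c hc hct
  by_cases hp : 2 * p ≤ A.dim
  · exact hlow p hp c hc hct
  · exact mem_algebraicClasses_of_lt_of_nonempty (nonempty_hardLefschetzNFold_holds A.dim A.X) hX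
      (by omega) (hlow (A.dim - p) (by omega)) c hc hct

/-- **HC for every sixfold OFF `𝒞`** (class target `HCOnClass fun A ↦ A.dim = 6 ∧ ¬ 𝒞 A`) from the dimension-6
census OFF `𝒞`, the Weil classes of all Weil sixfolds, and the floor — nothing about `𝒞`.
[cite: MoonenZarhin1999LowDim, §5; arXiv:math/9901113] -/
theorem hcOnClass_six_offClass : HCOnClass fun A ↦ A.dim = 6 ∧ ¬ 𝒞 A := fun A hA ↦
  ⟨nonempty_hodgeModel_holds AbelianVariety.isSmoothProjective_holds,
    mem_algebraicClasses_of_dim_six_offClass h₃ h₂ h₄ h₅ A hA.1 hA.2⟩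

end OffClass

/-! ## §2 Instantiation: `𝒞 = CM ∪ K3P` (the residue class of TABLE X), floor by Markman, `W₆` by name -/

/-- **TABLE X, OFF THE RESIDUE (dimension 6; `W₆` by name).** GRANTED Markman's fourfold theorem (floor
`dim ≤ 5`), the Weil classes of abelian sixfolds (`WeilSixfolds`, rung H2 by name; OPEN off the hyperbolic
components) and the two dimension-6 census nodes of TABLE X (OURS, not print), the Hodge conjecture holds for every
complex abelian SIXFOLD that is neither of CM type nor in the K3-partner cell. No `HC_CM`, no R-K3P.
[cite: MoonenZarhin1999LowDim, Thms. 0.1–0.2, §5] [claim: Markman2025SurveySecant, status: under-review] -/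
theorem hcOnClass_six_offResidue_of_tableX (hMark : Markman2025_weilClasses_algebraic_abelianFourfold)
    (hW₆ : Theses.SevenfoldWeilCensus.WeilSixfolds)
    (hX2 : SixfoldCodimTwoCensus) (hX1 : SixfoldCodimThreeCensus) :
    HCOnClass fun A ↦ A.dim = 6 ∧
      ¬ (IsOfCMType A ∨ ProdCMCell IsQuarticFieldTypeIVFourfold (fun Z ↦ Z.dim = 2) A) :=
  hcOnClass_six_offClass
    (𝒞 := fun A ↦ IsOfCMType A ∨ ProdCMCell IsQuarticFieldTypeIVFourfold (fun Z ↦ Z.dim = 2) A)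
    hX2 hX1 (fun d hd B ψ hB hψ w hw hwt hweil ↦
      weilSixfoldsOff_of_weilSixfolds (fun _ ↦ False) hW₆ d hd B ψ hB hψ not_false w hw hwt hweil)
    (Ring2.RowFourClosed.hcUpToDim_five_of_markman hMark)

/-- **TABLE X, OFF THE RESIDUE, RESIDUE R-W6 NAMED (dimension 6) — the charter's per-variety theorem.** GRANTED the
two Markman facts (fourfolds: floor `dim ≤ 5`; hyperbolic sixfolds: the printed Weil range, UNREFEREED — Schoen
`ℚ(√-3)` / Koike `ℚ(i)` refereed), the residue R-W6 = `WeilTypeLadder.NonsplitSixfolds` (Weil classes on the sixfolds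
admitting NO hyperbolic `K`-symmetrised hyperplane class; OPEN for every `K`) and the two dimension-6 census nodes
(OURS), the Hodge conjecture holds for every complex abelian SIXFOLD outside the residue class `CM ∪ K3P`. The
binders `HC_CM` (even narrowed), the CM-splitness `hS` and R-K3P of the landed cover do NOT occur: off the residue
they are not needed. None of the hypotheses is asserted. [cite: MoonenZarhin1999LowDim, Thms. 0.1–0.2, §5]
[cite: Markman2025SecantWeil, Thm. 1.5.1 (preprint, unrefereed)] [claim: Markman2025SurveySecant, status: under-review]
[cite: vanGeemen1994HodgeAV, (5.4.1)] -/
theorem hcOnClass_six_offResidue_of_tableX_residues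
    (hMark₄ : Markman2025_weilClasses_algebraic_abelianFourfold)
    (hMark₆ : Markman2025_weilClasses_algebraic_hyperbolicSixfold)
    (hRW6 : WeilTypeLadder.NonsplitSixfolds)
    (hX2 : SixfoldCodimTwoCensus) (hX1 : SixfoldCodimThreeCensus) :
    HCOnClass fun A ↦ A.dim = 6 ∧
      ¬ (IsOfCMType A ∨ ProdCMCell IsQuarticFieldTypeIVFourfold (fun Z ↦ Z.dim = 2) A) :=
  hcOnClass_six_offResidue_of_tableX hMark₄
    (WeilTypeLadder.weilSixfolds_of_nonsplitSixfolds_of_floor hMark₆ hRW6) hX2 hX1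

/-- Per-variety spelling of the same theorem (`HodgeConjectureFor` for ONE sixfold off the residue).
[cite: MoonenZarhin1999LowDim, Thms. 0.1–0.2, §5] [cite: Markman2025SecantWeil, Thm. 1.5.1 (preprint, unrefereed)] -/
theorem hodgeConjectureFor_of_dim_six_offResidue
    (hMark₄ : Markman2025_weilClasses_algebraic_abelianFourfold)
    (hMark₆ : Markman2025_weilClasses_algebraic_hyperbolicSixfold)
    (hRW6 : WeilTypeLadder.NonsplitSixfolds)
    (hX2 : SixfoldCodimTwoCensus) (hX1 : SixfoldCodimThreeCensus)
    (A : AbelianVariety ℂ) (h6 : A.dim = 6) (hCM : ¬ IsOfCMType A)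
    (hK3P : ¬ ProdCMCell IsQuarticFieldTypeIVFourfold (fun Z ↦ Z.dim = 2) A) :
    HodgeConjectureFor A.dim A.X :=
  hcOnClass_six_offResidue_of_tableX_residues hMark₄ hMark₆ hRW6 hX2 hX1 A ⟨h6, fun h ↦ h.elim hCM hK3P⟩

/-! ## §3 Audit: nothing lost, and on path -/

/-- **Re-assembly**: HC off the residue class in dimension 6 and HC on the residue class in dimension 6 give back
`HCAtDim 6` — so the landed cover `hcAtDim_six_of_tableX_residues` is exactly (this module) + (the residue binders).
[folklore] -/
theorem hcAtDim_six_of_offResidue_of_onResidue {𝒞 : AbelianVariety ℂ → Prop}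
    (hoff : HCOnClass fun A ↦ A.dim = 6 ∧ ¬ 𝒞 A) (hon : HCOnClass fun A ↦ 𝒞 A ∧ A.dim = 6) : HCAtDim 6 := by
  intro A h6
  by_cases hA : 𝒞 A
  · exact hon A ⟨hA, h6⟩
  · exact hoff A ⟨h6, hA⟩

/-- The landed cover, re-derived through §2 + the residue binders of `SixfoldTableXCover` §2 (consistency check;
same hypotheses as `hcAtDim_six_of_tableX_residues`). [cite: MoonenZarhin1999LowDim, Thms. 0.1–0.2, §5]
[cite: Markman2025SecantWeil, Thm. 1.5.1 (preprint, unrefereed)] -/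
theorem hcAtDim_six_of_tableX_residues' (hMark₄ : Markman2025_weilClasses_algebraic_abelianFourfold)
    (hMark₆ : Markman2025_weilClasses_algebraic_hyperbolicSixfold)
    (hCM : Theses.RankFourFaces.CMAbelianHodge) (hK3P : HodgeQuarticTypeIVFourfoldTimesCMSurface)
    (hRW6 : WeilTypeLadder.NonsplitSixfolds)
    (hX2 : SixfoldCodimTwoCensus) (hX1 : SixfoldCodimThreeCensus) : HCAtDim 6 :=
  hcAtDim_six_of_offResidue_of_onResidue
    (hcOnClass_six_offResidue_of_tableX_residues hMark₄ hMark₆ hRW6 hX2 hX1)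
    (hcOnClass_residueClass_six hCM hK3P)

/-- Audit: the off-residue class target is a case of the summit. [cite: Deligne2000, §1] -/
theorem hcOnClass_six_offResidue_of_hodgeConjecture (h : _root_.HodgeConjecture) :
    HCOnClass fun A ↦ A.dim = 6 ∧
      ¬ (IsOfCMType A ∨ ProdCMCell IsQuarticFieldTypeIVFourfold (fun Z ↦ Z.dim = 2) A) :=
  hcOnClass_of_hodgeConjecture _ h

end Summit.HodgeConjecture.HodgeConjecture.TableX
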